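import Literature.Combinatorics.SimpleGraph.RootedForestMatrixTree
import HarnessLib

/-!
# The weighted matrix-forest theorem: principal minors of the Laplacian of a weighted digraph
# are the generating functions of its rooted spanning forests (Fiedler–Sedláček / Chaiken;
# Chebotarev–Agaev Thm 2; the "Principal Minors Matrix-Tree Theorem" of Borcea–Brändén–Liggett §3.4)

Sources (held texts; statements VERBATIM).
* P. Chebotarev, R. Agaev, *Forest matrices around the Laplacian matrix*, Linear Algebra Appl. 356
  (2002) 253–274 [ChebotarevAgaev2002] (held `paper:arxiv-math_0508178`, §3 p. 6): «By definition,
  `L` has the form `L = D − W`, where `W` is the nonnegative matrix of arc weights and `D` is the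
  diagonal matrix ensuring the zero row sums of `L`. […] Fiedler and Sedláček [FiedlerSedlacek58]
  obtained an interpretation of all principal minors of the Laplacian matrix in terms of spanning
  forests: **Theorem 2.** For any `𝒥 ⊆ {1,…,n}`, `det L(𝒥̄ | 𝒥̄) = ε(ℱ^{→𝒥})` holds, where `ℱ^{→𝒥}`
  is the set of in-forests for which `𝒥` is the set of roots. Later this theorem was formulated and
  proved in [ChaikenKleitman78].» (`ε` = total weight, the weight of a forest being the product of
  its arc weights; `L(𝒥̄ | 𝒥̄)` = the submatrix of `L` with the rows and columns of `𝒥` deleted.)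
* S. Chaiken, *A combinatorial proof of the all minors matrix tree theorem*, SIAM J. Alg. Disc.
  Meth. 3 (1982) 319–329 [Chaiken1982] — the all-minors theorem, of which the principal case is the
  above (bib note: «the minor of a zero-row-sum matrix with rows `W` and columns `U` deleted is the
  signed count of spanning forests rooted at `W` in which each tree contains exactly one vertex of
  `U`»; here `U = W`).
* J. Borcea, P. Brändén, T. M. Liggett, *Negative dependence and the geometry of polynomials*,
  J. Amer. Math. Soc. 22 (2009) [BorceaBrandenLiggett2007], §3.4 (arXiv p. 12): «Let `L(G) = Σ_{e∈E}
  w_e A_e`. […] The Principal Minors Matrix-Tree Theorem (see, e.g., [Chaiken]) says that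
  `f_G(z,w) = det(L(G) + Z) = Σ_F z^{roots(F)} w^{edges(F)}`, where the sum is over all rooted
  spanning forests `F` in `G`.»

What is formalised.  For a finite vertex type `V`, ARBITRARY arc weights `a : V → V → R` in a
commutative ring (`a u v` = weight of the arc `u → v`; loops `a u u` are ignored) and a set
`s : Finset V` of NON-root vertices (roots `sᶜ`):

* `wLaplacian a` — the (row, out-weight) Laplacian `L = D − W`: `L u v = −a u v` (`u ≠ v`),
  `L u u = Σ_{w ≠ u} a u w` (zero row sums, `wLaplacian_mulVec_one`).
* **`det_wLaplacian_submatrix`** — THE WEIGHTED MATRIX-FOREST THEOREM: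
  `det (L restricted to s × s) = Σ_{τ} Π_{v ∈ s} a v (τ v)`, the sum over the spanning forests of
  the complete digraph rooted at `sᶜ`, recorded as in the tree (`CayleyForests`,
  `RootedForestMatrixTree`) by their parent maps `τ : V → V` (`IsForestOn univ sᶜ τ`: `τ` fixes
  `sᶜ` and every vertex reaches `sᶜ` under iteration; the arcs of the forest are `v → τ v`, `v ∈ s`,
  pointing TOWARDS the roots — Chebotarev–Agaev's in-forests "converging to" `sᶜ`; a forest using an
  arc of weight `0` contributes `0`, so no adjacency side condition is needed).
* `det_wLaplacian_submatrix_compl_singleton` (one root `r`: Tutte's directed matrix-tree theorem,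
  «`ℓ^{ii} = ε(𝒯^{→i})`», Chebotarev–Agaev Thm 1 for diagonal cofactors), `det_wLaplacian` (`s = univ`,
  `V` nonempty: `det L = 0`), and the sanity bridge `wLaplacian_adj` (0/1 weights of a simple graph
  give Mathlib's `SimpleGraph.lapMatrix`, so the tree's unweighted `RootedForestMatrixTree` theorem is
  the special case `a = [u ∼ v]`).

Proof.  Exactly the route of the tree's `RootedForestMatrixTree` (unweighted case), with counts
replaced by weighted sums: transport along `e : s ≃ Fin N` and evaluate Tutte's generic directed
matrix-tree theorem `Literature.Barriers.ValiantsHypothesis.det_stLaplacian`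
(`det (stLaplacian R N) = Σ_{t arborescence} Π_i x_{(i, t i)}`, complete digraph on `Option (Fin N)`,
root `none` = all of `sᶜ` collapsed to one vertex) at `x_{(i, some j)} := a (e⁻¹ i) (e⁻¹ j)` and
`x_{(i, none)} := Σ_{r ∈ sᶜ} a (e⁻¹ i) r`: the generic reduced Laplacian becomes `L|_{s×s}`, and for
each arborescence `t` the rooted forests with shadow `t` form the box "`τ(e⁻¹ i) = e⁻¹ j` if
`t i = some j`, `τ(e⁻¹ i) ∈ sᶜ` arbitrary if `t i = none`", over which the weights sum to
`Π_i x_{(i, t i)}` (a product of sums).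

THEOREMS plus ONE definition with body (`wLaplacian`); no named fact, no instance.

## References
* [ChebotarevAgaev2002] P. Chebotarev, R. Agaev, Forest matrices around the Laplacian matrix, LAA 356
  (2002), §3 Theorems 1–2.
* [Chaiken1982] S. Chaiken, A combinatorial proof of the all minors matrix tree theorem, SIAM J.
  Algebraic Discrete Methods 3 (1982).
* [BorceaBrandenLiggett2007] J. Borcea, P. Brändén, T. M. Liggett, JAMS 22 (2009), §3.4.
* [Biggs1974] N. Biggs, Algebraic Graph Theory, Ch. 7 (the unweighted case, tree
  `RootedForestMatrixTree`). [JerrumSnir1982] §5.1 (the generic arborescence determinant).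
* Related tree files (UNWEIGHTED simple graphs, `L = G.lapMatrix`): `RootedForestMatrixTree`
  (Theorem 2 with unit weights), `MatrixForestTheorem` (`det(I + L)`, Chebotarev–Agaev Thms 3, 3′),
  `LaplacianCoefficientsForests` (Biggs Thm 7.5). The present file is the version with ARBITRARY arc
  weights (a polynomial identity when the weights are indeterminates), which is what
  Borcea–Brändén–Liggett's `f_G(z,w)` requires.
-/

namespace Literature.Combinatorics.SimpleGraph.WeightedMatrixForest

open Finset Function Matrix Literature.Combinatorics.Enumerative
  Literature.Barriers.ValiantsHypothesis

variable {V : Type*} [Fintype V] [DecidableEq V]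

/-! ### § Laplacian — the Laplacian `L = D − W` of a weighted digraph -/

section Laplacian

variable {R : Type*} [CommRing R]

/-- **The Laplacian of a weighted digraph** with arc weights `a u v` (arc `u → v`): `L = D − W`,
off-diagonal entries `−a u v`, diagonal entries the out-weights `Σ_{w ≠ u} a u w` («`D` is the
diagonal matrix ensuring the zero row sums of `L`»). [cite: ChebotarevAgaev2002, §3 (L = D − W)]
[cite: BorceaBrandenLiggett2007, §3.4 (L(G) = Σ_e w_e A_e)] -/
def wLaplacian (a : V → V → R) : Matrix V V R :=
  Matrix.of fun u v => if u = v then ∑ w ∈ univ.erase u, a u w else -a u v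

/-- Diagonal entries: the out-weight of `u`. [cite: ChebotarevAgaev2002, §3 (L = D − W)] -/
theorem wLaplacian_apply_self (a : V → V → R) (u : V) :
    wLaplacian a u u = ∑ w ∈ univ.erase u, a u w := by
  simp [wLaplacian]

/-- Off-diagonal entries: minus the arc weight. [cite: ChebotarevAgaev2002, §3 (L = D − W)] -/
theorem wLaplacian_apply_of_ne (a : V → V → R) {u v : V} (h : u ≠ v) :
    wLaplacian a u v = -a u v := by
  simp [wLaplacian, h]

/-- Zero row sums: `L 𝟙 = 0`. [cite: ChebotarevAgaev2002, §3 («the diagonal matrix ensuring the zero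
row sums of L»)] -/
theorem wLaplacian_mulVec_one (a : V → V → R) : (wLaplacian a).mulVec (fun _ => 1) = 0 := by
  funext u
  rw [Matrix.mulVec, Pi.zero_apply]
  simp only [dotProduct, mul_one]
  rw [← Finset.add_sum_erase _ _ (mem_univ u), wLaplacian_apply_self]
  have h2 : ∑ x ∈ univ.erase u, wLaplacian a u x = ∑ x ∈ univ.erase u, (-a u x) :=
    sum_congr rfl fun x hx => wLaplacian_apply_of_ne a (ne_of_mem_erase hx).symm
  rw [h2, sum_neg_distrib, add_neg_cancel]

/-- The `0/1` weights of a simple graph give Mathlib's Laplacian `L(G) = D − A` — so the tree's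
unweighted matrix-forest theorem (`RootedForestMatrixTree`) is the case `a u v = [u ∼ v]` of the
weighted one below. [cite: Biggs1974, Ch. 7 (Q = D Dᵗ)] [cite: ChebotarevAgaev2002, §3] -/
theorem wLaplacian_adj (G : _root_.SimpleGraph V) [DecidableRel G.Adj] :
    wLaplacian (fun u v => if G.Adj u v then (1 : R) else 0) = G.lapMatrix R := by
  ext u v
  by_cases h : u = v
  · subst h
    rw [wLaplacian_apply_self]
    simp only [SimpleGraph.lapMatrix, SimpleGraph.degMatrix, Matrix.sub_apply, Matrix.diagonal_apply_eq,
      SimpleGraph.adjMatrix_apply, SimpleGraph.irrefl, if_false, sub_zero]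
    rw [G.degree_eq_sum_if_adj (R := R) u, ← Finset.add_sum_erase _ _ (mem_univ u), if_neg (G.irrefl),
      zero_add]
  · rw [wLaplacian_apply_of_ne _ h]
    simp [SimpleGraph.lapMatrix, SimpleGraph.degMatrix, Matrix.diagonal_apply_ne _ h,
      SimpleGraph.adjMatrix_apply]

end Laplacian

/-! ### § Roots — parent maps rooted at `sᶜ` and the collapse `π : V → Option (Fin N)`
(as in the tree's `RootedForestMatrixTree`) -/

section Roots

variable {s : Finset V} {N : ℕ} (e : s ≃ Fin N)
  {π : V → Option (Fin N)} (hπ₁ : ∀ (v : V) (h : v ∈ s), π v = some (e ⟨v, h⟩))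
  (hπ₂ : ∀ v, v ∉ s → π v = none)

/-- `IsForestOn univ sᶜ τ` unfolded. [cite: Biggs1974, Lemma 7.4 (3) (one vertex from each
component — the roots)] -/
private theorem isForestOn_univ_compl_iff {τ : V → V} :
    IsForestOn (univ : Finset V) sᶜ τ ↔ (∀ v, v ∉ s → τ v = v) ∧ ∀ v, ∃ n : ℕ, τ^[n] v ∉ s := by
  unfold IsForestOn
  simp only [mem_univ, true_imp_iff, mem_sdiff, mem_compl, not_not, true_and]

include hπ₁ in
omit [Fintype V] [DecidableEq V] in
/-- The collapse of `e⁻¹ i` is `some i`. [folklore] -/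
private theorem proj_symm (i : Fin N) : π (e.symm i : V) = some i := by
  rw [hπ₁ _ (e.symm i).2, Subtype.coe_eta, Equiv.apply_symm_apply]

include hπ₁ hπ₂ in
omit [Fintype V] [DecidableEq V] in
/-- The collapse is `none` exactly off `s`. [folklore] -/
private theorem proj_eq_none_iff {v : V} : π v = none ↔ v ∉ s := by
  by_cases h : v ∈ s
  · simp [hπ₁ v h, h]
  · simp [hπ₂ v h, h]

include hπ₁ hπ₂ in
omit [Fintype V] [DecidableEq V] in
/-- The collapse is `some j` exactly at `e⁻¹ j`. [folklore] -/
private theorem proj_eq_some_iff {v : V} {j : Fin N} : π v = some j ↔ v = (e.symm j : V) := by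
  constructor
  · intro h
    by_cases hv : v ∈ s
    · rw [hπ₁ v hv, Option.some_inj] at h
      rw [← h, Equiv.symm_apply_apply]
    · rw [hπ₂ v hv] at h
      exact absurd h (by simp)
  · rintro rfl
    exact proj_symm e hπ₁ j

include hπ₁ hπ₂ in
omit [Fintype V] [DecidableEq V] in
/-- `π ∘ τ = parentMap (Φ τ) ∘ π` for the shadow `Φ τ i = π (τ (e⁻¹ i))`, when `τ` fixes the
roots. [folklore] -/
private theorem semiconj_proj {τ : V → V} (hfix : ∀ v, v ∉ s → τ v = v) :
    Semiconj π τ (parentMap fun i => π (τ (e.symm i))) := by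
  intro v
  by_cases h : v ∈ s
  · rw [hπ₁ v h, parentMap_some]
    simp
  · rw [hπ₂ v h, parentMap_none, hfix v h, hπ₂ v h]

include hπ₁ hπ₂ in
omit [Fintype V] [DecidableEq V] in
/-- A parent map fixing the roots reaches the roots from everywhere iff its shadow is an
arborescence. [folklore] -/
private theorem forall_exists_iterate_iff {τ : V → V} (hfix : ∀ v, v ∉ s → τ v = v) :
    (∀ v, ∃ n : ℕ, τ^[n] v ∉ s) ↔ IsArborescence fun i => π (τ (e.symm i)) := by
  have key : ∀ (v : V) (n : ℕ),
      π (τ^[n] v) = (parentMap fun i => π (τ (e.symm i)))^[n] (π v) :=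
    fun v n => (semiconj_proj e hπ₁ hπ₂ hfix).iterate_right n v
  constructor
  · intro h i
    obtain ⟨n, hn⟩ := h (e.symm i)
    refine ⟨n, ?_⟩
    rw [← proj_symm e hπ₁ i, ← key, proj_eq_none_iff e hπ₁ hπ₂]
    exact hn
  · intro h v
    by_cases hv : v ∈ s
    · obtain ⟨n, hn⟩ := h (e ⟨v, hv⟩)
      refine ⟨n, ?_⟩
      rw [← proj_eq_none_iff e hπ₁ hπ₂, key, hπ₁ v hv]
      exact hn
    · exact ⟨0, hv⟩

end Roots

/-! ### § Sum — the arborescence polynomial at the collapsed weights is the forest generating sum -/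

section Sum

variable {R : Type*} [CommRing R] (a : V → V → R) {s : Finset V} {N : ℕ} (e : s ≃ Fin N)
  {π : V → Option (Fin N)} (hπ₁ : ∀ (v : V) (h : v ∈ s), π v = some (e ⟨v, h⟩))
  (hπ₂ : ∀ v, v ∉ s → π v = none)
  {B : Fin N → Option (Fin N) → Finset V}
  (hB₁ : ∀ i, B i none = sᶜ) (hB₂ : ∀ i j, B i (some j) = {(e.symm j : V)})

/-! The boxes `B i o` are the allowed images of `e⁻¹ i` under a rooted forest whose shadow sends
`i` to `o`: for `o = some j` the vertex `e⁻¹ j`, for `o = none` any root. -/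

include hπ₁ hπ₂ hB₁ hB₂ in
/-- Membership in the box is having the prescribed collapse. [folklore] -/
private theorem mem_box_iff {i : Fin N} {o : Option (Fin N)} {u : V} : u ∈ B i o ↔ π u = o := by
  cases o with
  | none => rw [hB₁, mem_compl, proj_eq_none_iff e hπ₁ hπ₂]
  | some j => rw [hB₂, mem_singleton, proj_eq_some_iff e hπ₁ hπ₂]

open Classical in
/-- Membership in `forests univ sᶜ` unfolded. [folklore] -/
private theorem mem_forests_iff {τ : V → V} :
    τ ∈ forests (univ : Finset V) sᶜ ↔ (∀ v, v ∉ s → τ v = v) ∧ ∀ v, ∃ n : ℕ, τ^[n] v ∉ s := by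
  rw [mem_forests, isForestOn_univ_compl_iff]

include hπ₁ hπ₂ hB₁ hB₂ in
open Classical in
/-- **The fibre sum**: for an arborescence `t`, the rooted forests with shadow `t` are in bijection
with the box `Π_i B i (t i)` (restrict `τ` to `s`; conversely extend a choice `g` by the identity on
the roots), and along it `Π_i a (e⁻¹ i) (τ (e⁻¹ i)) = Π_i a (e⁻¹ i) (g i)`; summing over the box
gives a product of sums. [folklore] -/
private theorem sum_fiber (t : Fin N → Option (Fin N)) (ht : IsArborescence t) :
    ∑ τ ∈ (forests (univ : Finset V) sᶜ).filter (fun τ => (fun i => π (τ (e.symm i))) = t),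
        ∏ i, a (e.symm i : V) (τ (e.symm i)) =
      ∏ i, ∑ u ∈ B i (t i), a (e.symm i : V) u := by
  rw [Finset.prod_univ_sum]
  refine sum_bij' (fun τ _ => fun i => τ (e.symm i))
    (fun g _ => fun u => if h : u ∈ s then g (e ⟨u, h⟩) else u) ?_ ?_ ?_ ?_ ?_
  · -- restriction lands in the box
    intro τ hτ
    rw [mem_filter] at hτ
    obtain ⟨-, hshadow⟩ := hτ
    rw [Fintype.mem_piFinset]
    intro i
    rw [mem_box_iff e hπ₁ hπ₂ hB₁ hB₂]
    exact congrFun hshadow i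
  · -- extension is a rooted forest with shadow `t`
    intro g hg
    rw [Fintype.mem_piFinset] at hg
    set τ : V → V := fun u => if h : u ∈ s then g (e ⟨u, h⟩) else u with hτ_def
    have hfix : ∀ v, v ∉ s → τ v = v := fun v hv => by simp [hτ_def, hv]
    have hval : ∀ i : Fin N, τ (e.symm i) = g i := fun i => by
      simp [hτ_def, (e.symm i).2]
    have hshadow : (fun i => π (τ (e.symm i))) = t := by
      funext i
      rw [hval]
      exact (mem_box_iff e hπ₁ hπ₂ hB₁ hB₂).1 (hg i)
    rw [mem_filter, mem_forests_iff]
    refine ⟨⟨hfix, ?_⟩, hshadow⟩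
    rw [forall_exists_iterate_iff e hπ₁ hπ₂ hfix, hshadow]
    exact ht
  · -- left inverse
    intro τ hτ
    rw [mem_filter, mem_forests_iff] at hτ
    funext u
    by_cases hu : u ∈ s
    · simp [hu]
    · simp [hu, hτ.1.1 u hu]
  · -- right inverse
    intro g hg
    funext i
    simp [(e.symm i).2]
  · -- weights agree
    intro τ hτ
    rfl

include hπ₁ hπ₂ in
open Classical in
/-- The shadow of a rooted forest is an arborescence. [folklore] -/
private theorem shadow_mem {τ : V → V} (hτ : τ ∈ forests (univ : Finset V) sᶜ) :
    (fun i => π (τ (e.symm i))) ∈ (univ : Finset (Fin N → Option (Fin N))).filter IsArborescence := by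
  rw [mem_forests_iff] at hτ
  rw [mem_filter]
  exact ⟨mem_univ _, (forall_exists_iterate_iff e hπ₁ hπ₂ hτ.1).1 hτ.2⟩

include hπ₁ hπ₂ hB₁ hB₂ in
open Classical in
/-- **Rooted forests summed through their shadows**:
`Σ_{τ} Π_i a (e⁻¹ i) (τ (e⁻¹ i)) = Σ_{t arborescence} Π_i Σ_{u ∈ B i (t i)} a (e⁻¹ i) u`. [folklore] -/
private theorem sum_forests_eq_sum :
    ∑ τ ∈ forests (univ : Finset V) sᶜ, ∏ i, a (e.symm i : V) (τ (e.symm i)) =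
      ∑ t ∈ (univ : Finset (Fin N → Option (Fin N))).filter IsArborescence,
        ∏ i, ∑ u ∈ B i (t i), a (e.symm i : V) u := by
  rw [← Finset.sum_fiberwise_of_maps_to (g := fun τ : V → V => fun i => π (τ (e.symm i)))
    (t := univ.filter IsArborescence) fun τ hτ => shadow_mem e hπ₁ hπ₂ hτ]
  refine sum_congr rfl fun t ht => ?_
  exact sum_fiber a e hπ₁ hπ₂ hB₁ hB₂ t (mem_filter.1 ht).2

include hB₁ hB₂ in
/-- The collapsed weights: `x_{(i, some j)} ↦ a (e⁻¹ i) (e⁻¹ j)`, `x_{(i, none)} ↦ Σ_{r ∈ sᶜ} a (e⁻¹ i) r`,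
as box sums. [folklore] -/
private theorem sum_box (i : Fin N) (o : Option (Fin N)) :
    ∑ u ∈ B i o, a (e.symm i : V) u =
      Option.elim o (∑ r ∈ sᶜ, a (e.symm i : V) r) fun j => a (e.symm i : V) (e.symm j : V) := by
  cases o with
  | none => rw [hB₁]; rfl
  | some j => rw [hB₂, sum_singleton]; rfl

omit [Fintype V] [DecidableEq V] in
/-- `Π_{v ∈ s}` re-indexed along `e : s ≃ Fin N`. [folklore] -/
private theorem prod_eq_prod_fin (f : V → R) : ∏ v ∈ s, f v = ∏ i : Fin N, f (e.symm i : V) := by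
  rw [← prod_coe_sort s]
  exact Fintype.prod_equiv e _ _ fun x => by rw [Equiv.symm_apply_apply]

include hπ₁ hπ₂ hB₁ hB₂ in
open Classical in
/-- **The arborescence polynomial at the collapsed weights is the forest generating sum.**
[folklore] -/
private theorem eval_stPoly :
    MvPolynomial.eval (fun p : Fin N × Option (Fin N) =>
        Option.elim p.2 (∑ r ∈ sᶜ, a (e.symm p.1 : V) r) fun j => a (e.symm p.1 : V) (e.symm j : V))
        (stPoly R N) =
      ∑ τ ∈ forests (univ : Finset V) sᶜ, ∏ v ∈ s, a v (τ v) := by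
  simp only [prod_eq_prod_fin e]
  rw [sum_forests_eq_sum a e hπ₁ hπ₂ hB₁ hB₂, stPoly, map_sum]
  refine sum_congr rfl fun t _ => ?_
  rw [map_prod]
  refine Fintype.prod_congr _ _ fun i => ?_
  rw [MvPolynomial.eval_X, sum_box a e hB₁ hB₂]

end Sum

/-! ### § Eval — the generic reduced Laplacian at the collapsed weights is `L|_{s×s}` -/

section Eval

variable {R : Type*} [CommRing R] (a : V → V → R) {s : Finset V} {N : ℕ} (e : s ≃ Fin N)

/-- The out-weight of `e⁻¹ i` splits as (arcs into `s`, indexed by `Fin N`, minus the loop) +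
(arcs into the roots). [folklore] -/
private theorem outWeight_eq (i : Fin N) :
    ∑ w ∈ univ.erase (e.symm i : V), a (e.symm i : V) w =
      (∑ j ∈ univ.erase i, a (e.symm i : V) (e.symm j : V)) + ∑ r ∈ sᶜ, a (e.symm i : V) r := by
  have hu : (e.symm i : V) ∈ s := (e.symm i).2
  have hsplit : univ.erase (e.symm i : V) = s.erase (e.symm i : V) ∪ sᶜ := by
    ext w
    simp only [mem_erase, mem_univ, and_true, mem_union, mem_compl]
    constructor
    · intro hw
      by_cases hws : w ∈ s
      · exact Or.inl ⟨hw, hws⟩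
      · exact Or.inr hws
    · rintro (⟨hw, -⟩ | hw)
      · exact hw
      · rintro rfl; exact hw hu
  have hdisj : Disjoint (s.erase (e.symm i : V)) sᶜ :=
    disjoint_left.2 fun w hw hw' => (mem_compl.1 hw') (mem_of_mem_erase hw)
  rw [hsplit, sum_union hdisj]
  congr 1
  -- `Σ_{w ∈ s.erase u} = Σ_{j ∈ univ.erase i}` along `e`
  rw [Finset.sum_erase_eq_sub hu, ← sum_coe_sort s, ← Finset.sum_erase_eq_sub (mem_univ (e.symm i))]
  exact sum_equiv e (fun x => by simp only [mem_erase, mem_univ, and_true]; exact not_congr e.eq_symm_apply)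
    (fun x _ => by rw [Equiv.symm_apply_apply])

/-- **At the collapsed weights the generic reduced Laplacian is `L` restricted to `s`, indexed
through `e`.** [folklore] -/
private theorem mapMatrix_eval_stLaplacian :
    (MvPolynomial.eval fun p : Fin N × Option (Fin N) =>
        Option.elim p.2 (∑ r ∈ sᶜ, a (e.symm p.1 : V) r) fun j => a (e.symm p.1 : V) (e.symm j : V)).mapMatrix
        (stLaplacian R N) =
      (wLaplacian a).submatrix (fun i => (e.symm i : V)) (fun i => (e.symm i : V)) := by
  ext i j
  rw [RingHom.mapMatrix_apply, Matrix.map_apply, Matrix.submatrix_apply]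
  by_cases hij : i = j
  · subst hij
    rw [stLaplacian_apply_self, map_sum, wLaplacian_apply_self, outWeight_eq a e]
    simp only [MvPolynomial.eval_X]
    rw [Finset.sum_erase_eq_sub (mem_univ _), Fintype.sum_option, Finset.sum_erase_eq_sub (mem_univ _)]
    simp only [Option.elim]
    ring
  · have hne : (e.symm i : V) ≠ (e.symm j : V) := fun h => hij (e.symm.injective (Subtype.ext h))
    rw [stLaplacian_apply_of_ne hij, map_neg, MvPolynomial.eval_X, wLaplacian_apply_of_ne _ hne]
    rfl

open Classical in
/-- The weighted matrix-forest theorem along the labelling `e`. [folklore] -/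
private theorem det_submatrix_eq_sum :
    ((wLaplacian a).submatrix (fun i => (e.symm i : V)) (fun i => (e.symm i : V))).det =
      ∑ τ ∈ forests (univ : Finset V) sᶜ, ∏ v ∈ s, a v (τ v) := by
  have h := congrArg
    (MvPolynomial.eval fun p : Fin N × Option (Fin N) =>
      Option.elim p.2 (∑ r ∈ sᶜ, a (e.symm p.1 : V) r) fun j => a (e.symm p.1 : V) (e.symm j : V))
    (det_stLaplacian R N)
  rw [RingHom.map_det, mapMatrix_eval_stLaplacian a e,
    eval_stPoly a e (π := fun v => if h : v ∈ s then some (e ⟨v, h⟩) else none)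
      (fun v h => dif_pos h) (fun v h => dif_neg h)
      (B := fun i o => Option.elim o sᶜ fun j => {(e.symm j : V)}) (fun i => rfl) (fun i j => rfl)] at h
  exact h

end Eval

/-! ### § MatrixForest — the theorem and its corollaries -/

section MatrixForest

variable {R : Type*} [CommRing R] (a : V → V → R) (s : Finset V)

open Classical in
/-- **The weighted matrix-forest theorem** (Fiedler–Sedláček; Chaiken–Kleitman; the principal case
of Chaiken's all-minors matrix-tree theorem; Borcea–Brändén–Liggett's "Principal Minors
Matrix-Tree Theorem"): for arc weights `a u v` in any commutative ring and every set `s` of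
vertices, the principal minor of the Laplacian `L = D − W` on the rows and columns indexed by `s`
is the generating function of the spanning forests rooted at `sᶜ` — parent maps `τ : V → V` fixing
`sᶜ` under which every vertex reaches `sᶜ`, weighted by the product of their arc weights
`Π_{v ∈ s} a v (τ v)` («`det L(𝒥̄ | 𝒥̄) = ε(ℱ^{→𝒥})`», `𝒥 = sᶜ`).
[cite: ChebotarevAgaev2002, §3 Theorem 2] [cite: Chaiken1982, §2 (All Minors Matrix Tree Theorem,
principal case W = U)] [cite: BorceaBrandenLiggett2007, §3.4 (Principal Minors Matrix-Tree Theorem)] -/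
theorem det_wLaplacian_submatrix :
    ((wLaplacian a).submatrix (Subtype.val : s → V) Subtype.val).det =
      ∑ τ ∈ forests (univ : Finset V) sᶜ, ∏ v ∈ s, a v (τ v) := by
  set e : s ≃ Fin (Fintype.card s) := Fintype.equivFin s
  have hf : (fun i => (e.symm i : V)) = Subtype.val ∘ e.symm := rfl
  rw [← det_submatrix_eq_sum a e, hf, ← Matrix.submatrix_submatrix, Matrix.det_submatrix_equiv_self]

open Classical in
/-- The theorem with `IsForestOn` unfolded: the sum is over the maps `τ : V → V` with `τ v = v` off
`s` and every vertex leaving `s` under iteration. [cite: ChebotarevAgaev2002, §3 Theorem 2] -/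
theorem det_wLaplacian_submatrix' :
    ((wLaplacian a).submatrix (Subtype.val : s → V) Subtype.val).det =
      ∑ τ ∈ (univ : Finset (V → V)).filter
          (fun τ => (∀ v, v ∉ s → τ v = v) ∧ ∀ v, ∃ n : ℕ, τ^[n] v ∉ s),
        ∏ v ∈ s, a v (τ v) := by
  rw [det_wLaplacian_submatrix]
  refine sum_congr ?_ fun _ _ => rfl
  ext τ
  rw [mem_forests, mem_filter, isForestOn_univ_compl_iff]
  simp

open Classical in
/-- **One root — Tutte's directed matrix-tree theorem** (Chebotarev–Agaev Thm 1 for the diagonal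
cofactor `ℓ^{rr}`): the minor of `L` on `{r}ᶜ` is the generating function of the spanning
arborescences converging to `r` (parent maps rooted at `r`). [cite: ChebotarevAgaev2002, §3
Theorem 1 (diagonal cofactors)] [cite: JerrumSnir1982, §5.1] -/
theorem det_wLaplacian_submatrix_compl_singleton (r : V) :
    ((wLaplacian a).submatrix (Subtype.val : ↥({r}ᶜ : Finset V) → V) Subtype.val).det =
      ∑ τ ∈ forests (univ : Finset V) {r}, ∏ v ∈ univ.erase r, a v (τ v) := by
  rw [det_wLaplacian_submatrix, compl_compl, Finset.compl_singleton]

open Classical in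
/-- With no roots there are no rooted spanning forests on a nonempty vertex set: `det L = 0`
(`L 𝟙 = 0`). [cite: ChebotarevAgaev2002, §3 («L is a singular M-matrix»)] -/
theorem det_wLaplacian [Nonempty V] : (wLaplacian a).det = 0 := by
  have h := det_wLaplacian_submatrix a (univ : Finset V)
  have hempty : forests (univ : Finset V) (univ : Finset V)ᶜ = ∅ := by
    ext τ
    rw [mem_forests, isForestOn_univ_compl_iff]
    simp only [mem_univ, not_true_eq_false, IsEmpty.forall_iff, implies_true, true_and,
      Finset.notMem_empty, iff_false, not_forall, not_exists]
    exact ⟨Classical.arbitrary V, fun n => not_false⟩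
  rw [hempty, sum_empty] at h
  rw [← h]
  exact (Matrix.det_submatrix_equiv_self (Equiv.subtypeUnivEquiv mem_univ) (wLaplacian a)).symm

/-- **The unweighted case recovered**: with `a u v = [u ∼ v]` for a simple graph `G`, the weighted
theorem is the tree's matrix-forest theorem `RootedForestMatrixTree.det_lapMatrix_submatrix_eq_card_rootedForests`
(each rooted forest inside `G` has weight `1`, the others weight `0`).
[cite: Biggs1974, Lemma 7.4 and Theorem 7.5 (proof)] -/
theorem sum_forests_adj_eq_card (G : _root_.SimpleGraph V) [DecidableRel G.Adj] :
    (∑ τ ∈ forests (univ : Finset V) sᶜ, ∏ v ∈ s, (if G.Adj v (τ v) then (1 : R) else 0)) =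
      (Nat.card {τ : V → V // IsForestOn (univ : Finset V) sᶜ τ ∧ ∀ v ∈ s, G.Adj v (τ v)} : R) := by
  rw [← RootedForestMatrixTree.det_lapMatrix_submatrix_eq_card_rootedForests, ← wLaplacian_adj,
    det_wLaplacian_submatrix]

end MatrixForest

end Literature.Combinatorics.SimpleGraph.WeightedMatrixForest
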